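import Summits.QuantumFields.YangMills.Theorems.UnitScaleTiltEXGuardedFiveOutright
import Summits.QuantumFields.YangMills.Theorems.UnitScaleTiltHistoryTailLaneTailV4ChiDisplays
import Summits.QuantumFields.YangMills.Theorems.UnitScaleTiltFluctuationComparisonRegPrIntLT8OfHalvingExist
import HarnessLib

/-!
# Route `UnitScaleTilt` — EX OUT OF THE 19936 ROW AND OUT OF THE FIXED-BLOCK LEAF, AT EVERY ODD BLOCK SIZE `L₀ ≥ 5`:
# `⟨HistoryTailL's body at L⟩ ⟸ ⟨19936's registered NODE-O row (O‴χₛ) at L⟩` (odd `L ≥ 5`) and `YM3TorusSU2At L₀ ⟸ {⟨20520's body at L₀⟩, ⟨(O‴χₛ) at L₀⟩}` (`L₀ ≥ 5`)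

Cell `ym3-torus` (YM ladder rung R3 = continuum `SU(2)` Yang–Mills on T³ — a RUNG, NOT d = 4, NOT infinite volume, NOT a mass gap, NOT Clay); seat `ym-line-cst-p1` g39
(free prover hand); `--supports stmt-QuantumFields-19936 --as helper`, count-neutral, definition-free, default heartbeats; registry ∕ route ∕ display untouched.

WHY.  ✓p790882 `EXGuardedFiveOutright.exBody_guarded_five : ∀ L, 1 < L → 5 ≤ L → ⟨EX body⟩` (px16 g16) makes EX ([Balaban1985Variational] Prop. 7's existence clause from a
background (14)) OUTRIGHT at every `L ≥ 5`, yet its consumers read the sibling cruxes GLOBALLY (`ym3TorusSU2At_of_siblings (h201 : FluctuationComparisonRegPrIntL)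
(hK2 : HistoryTailL)`), and 19936's registry row EX (`Cruxes/HistoryTailL/Lines/unbundled_v6.lean`, SHARED with 19200 v10) is the SAME text.  Every door on the way is PER
BLOCK SIZE: ✓`IntLT8OfHalvingExist.thm1In8GlobalMinAt_of_halving_exist_L` (T8 at ONE `L` from ✓`stub_halvingStep L hL` and EX at `L`), ✓`pinnedPartsT3ACRecSelXsV4Chi_of_thm1_rows` +
✓`alphaInputsT3ACv4RecChi_of_pinnedPartsRecSelXsV4Chi` (χ-record at `L` from T8 at `L` and the (O‴χₛ) rows at `L`), ✓`intCoreRecRows_of_laneRecordsV4Chi L`, and the odd branch of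
✓`historyTailL_of_intCoreRecRows` reads `hrec L` only; likewise ✓p785993 §4 `ym3TorusSU2At_of_guardedCrux` uses `h201 F.L` and `hK2 F.L b₁ p₁` only.

WHAT THIS FILE PROVES (plumbing over landed theorems; every statement's «body at L» is the route decl's text under its leading `∀ (L : ℕ)`, VERBATIM).
* §1 `historyTailBody_of_intCoreRecRows_L (hLo : Odd L) (hL : 1 < L) (hrec : IntCoreRecRows L) : ⟨HistoryTailL's body at L⟩` — the odd branch of
  ✓`historyTailL_of_intCoreRecRows` at one block size (same proof: `perPlaquetteHigh_int`, `budget_of_c`, ✓`HistoryTailBoundedHeight.perPlaquette_of_split`,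
  ✓`HistoryTailBirthV3b.stub_tailOfPerPlaquette`, `historyTailAt_of_averagedTailAt`); `fun h => h : (∀ L, ⟨body at L⟩) → HistoryTailL` type-checks (the text IS the route decl's).
* §2 `historyTailBody_of_thm1In8_selXsV4DataRows_L (hT8_L) (hrows_L)` and §3 `historyTailBody_of_existence_selXsV4DataRows_L (hEX_L) (hrows_L)` — the per-`L` editions of
  ✓`historyTailL_of_thm1In8_selXsV4DataRows_allL` ∕ ✓`historyTailL_of_existenceMinimalOrbit_selXsV4DataRows_allL` (`hrows_L` = 19936's registered row `stub_selXsV4DataRows` read at `L`,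
  `hEX_L` = the row EX read at `L`, both VERBATIM).
* §4 ★★★ `historyTailBody_five_of_selXsV4DataRows (hLo : Odd L) (h5 : 5 ≤ L) (hrows_L) : ⟨HistoryTailL's body at L⟩` — **AT EVERY ODD `L ≥ 5` THE CRUX `HistoryTailL` READS ITS ONE
  NODE-O ROW (O‴χₛ) AT `L` AND NOTHING ELSE** (EX discharged by ✓`exBody_guarded_five`).
* §5 `ym3TorusSU2At_of_guardedCrux_bodies` (✓p785993 §4's E-INT glue re-keyed to the per-`L₀` bodies of BOTH siblings), ★★★ `ym3TorusSU2At_five_of_intLBody_selXsV4DataRows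
  (L₀) (h5 : 5 ≤ L₀) (h201_L₀ : ⟨FluctuationComparisonRegPrIntL's body at L₀⟩) (hrows_L₀) : YM3TorusSU2At L₀` — **THE FIXED-BLOCK LEAF AT EVERY `L₀ ≥ 5` ⟸ {20520 at `L₀`,
  (O‴χₛ) at `L₀`}** (`h200g` := ✓`minimiserStabilityRegPr_guarded_five`; even `L₀` vacuous) — and `ym3TorusSU2At_five_of_intL_selXsV4DataRows` ∕ `ym3TorusSU2Adm_of_intL_selXsV4DataRows`
  with the sibling crux `FluctuationComparisonRegPrIntL` BY NAME.

HONEST SCOPE (CREDIT NOTHING): compositions of landed theorems, no analysis; (O‴χₛ) (NODE O's Sel∕Xs v4 χ-data rows), `FluctuationComparisonRegPrIntL` (stmt-QuantumFields-20520)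
and `HistoryTailL` for ALL `L` (stmt-QuantumFields-19936 AS REGISTERED: its row EX is stated for all `L > 1`, so at `L = 3` it still reads EX ⟸ `hThm2S3` — the SAME `L = 3`
residue as 19200's) are NOT proved; `stub_existenceMinimalOrbit` ∕ 19200 AS REGISTERED (all `L > 1`) NOT closed; the leaf of record `YM3TorusSU2` (all odd `L > 1`, uniform `γ₁`)
NOT proved; registry №36 ∕ J-FREEZE untouched; rung R3 = SU(2) YM₃ on T³ — NOT d = 4, NOT infinite volume, NOT a mass gap, NOT Clay; the Yang–Mills mass gap is NOT proved.
Sorry-free, axioms standard.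

References: T. Bałaban, CMP **102** (1985) 255–275 [Balaban1985UV3] ((5), (47), (67)–(71), Thm 2); CMP **102** (1985) 277–309 [Balaban1985Variational] (Thm 1 (8) p.279,
Prop. 7 p.299, Prop. 8 p.304); CMP **109** (1987) 249–301 [Balaban1987RG1] (§0 p.251); C. King, CMP **102** (1986) 649–677 [King1986] ((3.12) p.657).
-/

set_option autoImplicit false

noncomputable section

namespace Summit.QuantumFields.YangMills.Theorems.HistoryTailGuardedFive

open MeasureTheory Filter Topology
open scoped Matrix.Norms.L2Operator
open Literature.MathematicalPhysics.QuantumFieldTheory.Balaban1983to89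
open Literature.MathematicalPhysics.QuantumFieldTheory.Balaban1983to89.T3ContinuumYM3Torus
open Literature.MathematicalPhysics.QuantumFieldTheory.Balaban1983to89.T3UnitLawDensityEML (ℰp measurableE_ℰp)
open Literature.MathematicalPhysics.QuantumFieldTheory.Balaban1983to89.T3UnitScaleTilt
open Literature.MathematicalPhysics.QuantumFieldTheory.Balaban1983to89.T3BareTailProfile
open Literature.MathematicalPhysics.QuantumFieldTheory.Balaban1983to89.T3ThresholdSmallness (sqrt_coupling_pos_le)
open Literature.MathematicalPhysics.QuantumFieldTheory.Balaban1983to89.T3Thresholds (coupling_le_one)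
open Literature.MathematicalPhysics.QuantumFieldTheory.Balaban1983to89.T3AlphaInputsAC
open Literature.MathematicalPhysics.QuantumFieldTheory.Balaban1983to89.T3InteriorExcision (FluctuationComparisonRegPrIntAt)
open Literature.MathematicalPhysics.QuantumFieldTheory.Balaban1983to89.T3PrintedRegularMinimiser
open Literature.MathematicalPhysics.QuantumFieldTheory.Balaban1983to89.T3PrintedMinimiserExistence (Thm1GlobalMinAt)
open Literature.MathematicalPhysics.QuantumFieldTheory.Balaban1983to89.T3LowerAlongMinimisersSplit (MinimisersIn8At)
open Literature.MathematicalPhysics.QuantumFieldTheory.Balaban1983to89.T3ConstrainedMinimiser (fibre)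
open Literature.MathematicalPhysics.QuantumFieldTheory.Balaban1983to89.ExpMeanLog (deltaSU)
open Literature.MathematicalPhysics.QuantumFieldTheory.Balaban1983to89.T3YM3TorusStatement (YM3TorusSU2Adm YM3TorusSU2At)
open Literature.MathematicalPhysics.QuantumFieldTheory.Balaban1985CMP102
open Literature.MathematicalPhysics.QuantumFieldTheory.Balaban1985CMP102.Setting
open Summit.QuantumFields.Balaban3D.Carriers (suGroupModel)
open Summit.QuantumFields.Balaban3D.Proofs.Primitives (AlphaConsts)
open Summit.QuantumFields.Balaban3D.Proofs.Thresholds (Q0)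
open B7Prop2Explicit (C0)
open Summit.QuantumFields.YangMills.Theses.UnitScaleTilt (FluctuationComparisonRegPrIntL HistoryTailL)
open Summit.QuantumFields.YangMills.Theorems
open Summit.QuantumFields.YangMills.Theorems.HistoryTailLaneNumerator (budget_of_c)
open Summit.QuantumFields.YangMills.Theorems.HistoryTailLaneTailIntRows (perPlaquetteHigh_int)
open Summit.QuantumFields.YangMills.Theorems.HistoryTailLaneTailV4Chi (intCoreRecRows_of_laneRecordsV4Chi)
open Summit.QuantumFields.YangMills.Theorems.HistoryTailSelSupplier (pinnedPartsT3ACRecSelXsV4Chi_of_thm1_rows)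
open Summit.QuantumFields.YangMills.Theorems.IntLT8OfHalvingExist (thm1In8GlobalMinAt_of_halving_exist_L)
open Summit.QuantumFields.YangMills.Theorems.MinimiserStabilityRegPrStubHalvingStep (stub_halvingStep)
open Summit.QuantumFields.YangMills.Theorems.EXGuardedFiveOutright (exBody_guarded_five minimiserStabilityRegPr_guarded_five)

/-! ## §1 `HistoryTailL`'s body at ONE odd block size from the record-free interior socket `IntCoreRecRows L` -/

/-- **`⟨HistoryTailL's body at L⟩ ⟸ IntCoreRecRows L`** (odd `L > 1`): the odd branch of ✓`HistoryTailLaneTailIntRows.historyTailL_of_intCoreRecRows` at ONE block size — records at the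
profile `(max b₁ b₁′, max p₁ p₁′)`, `perPlaquetteHigh_int`, `budget_of_c`, ✓`HistoryTailBoundedHeight.perPlaquette_of_split`, ✓`HistoryTailBirthV3b.stub_tailOfPerPlaquette`,
`historyTailAt_of_averagedTailAt`; the profile is fixed BEFORE the free top fraction `m`. [cite: Balaban1985UV3, (5) p.256 and (71) p.273; King1986, (3.12) p.657] -/
theorem historyTailBody_of_intCoreRecRows_L {L : ℕ} (hLo : Odd L) (hL : 1 < L) (hrec : AlphaInputsT3AC.IntCoreRecRows L) :
    ∀ (b₁ p₁ : ℝ), ∃ (b₀ p₀ : ℝ), b₁ ≤ b₀ ∧ p₁ ≤ p₀ ∧ 0 < b₀ ∧ 2 < p₀ ∧ ∀ (m : ℕ), 0 < m → ∃ γ₁ : ℝ, 0 < γ₁ ∧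
      ∀ (F : T3Family) (γ : ℝ), F.L = L → 0 < γ → γ ≤ γ₁ → T3UnitScaleTilt.HistoryTailAt F γ b₀ p₀ m := by
  -- adapted from ✓`HistoryTailLaneTailIntRows.perPlaquetteHighL_of_intCoreRecRows` ∕ `historyTailL_of_intCoreRecRows` (odd branch), `hrec L hLo hL` ↦ `hrec`
  intro b₁ p₁
  obtain ⟨b₁', p₁', hrec'⟩ := hrec
  obtain ⟨𝔠, a₁, hcb, hcp, ha1, h𝔠⟩ := hrec' (max b₁ b₁') (max p₁ p₁') (le_max_right _ _) (le_max_right _ _)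
  obtain ⟨κ, γ₁, cSF, hκ, hγ₁, hγ₁1, hc0, -, h⟩ := perPlaquetteHigh_int L hLo hL 𝔠 a₁ ha1 h𝔠
  have hr₀ : 0 ≤ 𝔠.r₀ := zero_le_one.trans 𝔠.one_le_r₀
  have hp : 1 + 3 * 𝔠.r₀ / 2 < 𝔠.p₀ := by
    have := 𝔠.one_le_r₀
    show 1 + 3 * 𝔠.r₀ / 2 < 2 * 𝔠.r₀ + 1
    linarith
  have hb1 : b₁ ≤ 𝔠.b₀ := hcb ▸ le_max_left _ _
  have hp1 : p₁ ≤ 𝔠.p₀ := hcp ▸ le_max_left _ _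
  have hb : 0 < 𝔠.b₀ := 𝔠.b₀_pos
  have hp2 : 2 < 𝔠.p₀ := 𝔠.two_lt_p₀
  obtain ⟨C₆, c, hC₆, hc, hbud⟩ := budget_of_c 𝔠.b₀ 𝔠.p₀ 𝔠.r₀ κ cSF hb hr₀ hκ hp hc0
  refine ⟨𝔠.b₀, 𝔠.p₀, hb1, hp1, hb, hp2, fun m hm => ⟨γ₁, hγ₁, fun F γ hFL hγ hle => ?_⟩⟩
  have hγ1 : γ ≤ 1 := hle.trans hγ₁1
  have hp01 : (1 : ℝ) ≤ 𝔠.p₀ := by linarith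
  have hL1 : 1 ≤ F.L := F.hL.2.le
  obtain ⟨j₀, C, A, hC, hhigh⟩ := h F γ hFL hγ hle
  have hhigh' : ∃ (C : ℝ) (A : ℕ) (c : ℝ), 0 ≤ C ∧ 0 < c ∧
      ∀ (K j : ℕ), j₀ < j → j ≤ K → ∀ p : Plaq (F.P K) j,
        (gibbsK F ℰp γ K).real
            {U | θBal F.L γ 𝔠.b₀ 𝔠.p₀ (K - j) ≤
              GaugeGroup.dist1 (GaugeField.plaqHol
                (Averaging.iter (fun _ => BlockAveraging.blockAvg ℰp) j U) p)} ≤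
          C * (F.scheme ℰp γ).β (K - j) ^ A *
            Real.exp (-(c * B10.pFun 𝔠.b₀ 𝔠.p₀ (Real.sqrt (γ * ((F.L : ℝ)⁻¹) ^ (K - j))) ^ 2)) := by
    refine ⟨C * C₆, A, c, mul_nonneg hC hC₆, hc, fun K j hj hjK p => ?_⟩
    have hg := sqrt_coupling_pos_le hL1 hγ (K - j)
    have hg1 := coupling_le_one hL1 hγ hγ1 (K - j)
    have hβA : 0 ≤ C * (F.scheme ℰp γ).β (K - j) ^ A :=
      mul_nonneg hC (pow_nonneg (F.scheme_β_nonneg ℰp hγ.le (K - j)) A)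
    calc (gibbsK F ℰp γ K).real
            {U | θBal F.L γ 𝔠.b₀ 𝔠.p₀ (K - j) ≤
              GaugeGroup.dist1 (GaugeField.plaqHol
                (Averaging.iter (fun _ => BlockAveraging.blockAvg ℰp) j U) p)}
          ≤ C * (F.scheme ℰp γ).β (K - j) ^ A *
              Real.exp (-(cSF * B10.pFun 𝔠.b₀ 𝔠.p₀ (Real.sqrt (γ * ((F.L : ℝ)⁻¹) ^ (K - j))) ^ 2) +
                κ * (1 + Real.log (Real.sqrt (γ * ((F.L : ℝ)⁻¹) ^ (K - j)))⁻¹) ^ (2 + 3 * 𝔠.r₀)) := hhigh K j hj hjK p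
      _ ≤ C * (F.scheme ℰp γ).β (K - j) ^ A *
              (C₆ * Real.exp (-(c * B10.pFun 𝔠.b₀ 𝔠.p₀ (Real.sqrt (γ * ((F.L : ℝ)⁻¹) ^ (K - j))) ^ 2))) :=
            mul_le_mul_of_nonneg_left (hbud _ hg.1 hg1) hβA
      _ = C * C₆ * (F.scheme ℰp γ).β (K - j) ^ A *
              Real.exp (-(c * B10.pFun 𝔠.b₀ 𝔠.p₀ (Real.sqrt (γ * ((F.L : ℝ)⁻¹) ^ (K - j))) ^ 2)) := by ring
  have hPP := HistoryTailBoundedHeight.perPlaquette_of_split j₀ F hγ hγ1 hb.le 𝔠.p₀ hhigh'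
  exact historyTailAt_of_averagedTailAt F hγ hγ1 hb hp01 hm
    (HistoryTailBirthV3b.stub_tailOfPerPlaquette F γ 𝔠.b₀ 𝔠.p₀ hγ hγ1 hb hp01 hPP)

/-! ## §2 … from T8 at `L` and 19936's registered row (O‴χₛ) at `L` -/

/-- **`⟨HistoryTailL's body at L⟩ ⟸ ⟨T8 at L⟩ ∧ ⟨(O‴χₛ) Sel∕Xs v4 supplier rows at L⟩`** (odd `L > 1`) — the per-block-size edition of
✓`HistoryTailLaneTailV4Chi.historyTailL_of_thm1In8_selXsV4DataRows_allL`: χ-record at `L` (✓`pinnedPartsT3ACRecSelXsV4Chi_of_thm1_rows`, ✓`alphaInputsT3ACv4RecChi_of_pinnedPartsRecSelXsV4Chi`),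
interior socket (✓`intCoreRecRows_of_laneRecordsV4Chi`), §1.  `hrows_L` = `unbundled_v6.lean`'s `stub_selXsV4DataRows` read at `L`, VERBATIM.
[cite: Balaban1985UV3, (5) p.256, (47) p.267, (67)–(71) p.273 and Thm 2 p.272; Balaban1985Variational, Thm 1 (8) p.279] -/
theorem historyTailBody_of_thm1In8_selXsV4DataRows_L {L : ℕ} (hLo : Odd L) (hL : 1 < L)
    (hT8_L : ∃ a₀ a₁ B₃ : ℝ, 0 < a₀ ∧ 0 < a₁ ∧ 0 < B₃ ∧ Thm1GlobalMinAt L a₀ a₁ B₃ ∧ MinimisersIn8At L a₀ a₁ B₃)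
    (hrows_L : ∃ (B₀ A₀ A₁ : ℝ), 0 < A₀ ∧ 0 < A₁ ∧
      ∀ (B a₀ a₁ : ℝ), B₀ ≤ B → 1 ≤ 2 * B → 0 < a₀ → a₀ ≤ A₀ → 0 < a₁ → a₁ ≤ A₁ → B * a₁ ≤ a₀ →
        (143 * ((((3 + 4 : ℕ) : ℝ)) ^ 2 / 4) ^ 2) * (2 * (B * a₁)) ≤ 1 / 3 →
        2 * (2 * (B * a₁)) ≤ 2 * deltaSU (Fin 2) / (((3 + 4) * L : ℕ) : ℝ) ^ 2 →
        Thm1GlobalMinAt L a₀ a₁ B →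
        ∃ (b₁ p₁ : ℝ), ∀ (b₀ p₀ : ℝ), b₁ ≤ b₀ → p₁ ≤ p₀ →
          ∃ 𝔠 : AlphaConsts L (suGroupModel 2).N, 𝔠.b₀ = b₀ ∧ 𝔠.p₀ = p₀ ∧ 𝔠.B₃ = B ∧
            4 * 𝔠.B₃ * (L : ℝ) ^ 2 * avgWindowFactor L ≤ 𝔠.C68 ∧
            Real.exp (𝔠.p₀ - 1) ≤ 3 * C0 3 * 𝔠.C68 * (𝔠.b₀ * Q0 𝔠.p₀) ∧
            (𝔠.b₀ * Q0 𝔠.p₀) * (2 * (L : ℝ) ^ 2 * avgWindowFactor L) ^ 2 ≤ 3 * C0 3 * 𝔠.C68 * a₁ ^ 2 ∧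
            ∀ (F : T3Family) (hF : F.L = L),
              (∀ (γ : ℝ) (hγ : 0 < γ) (hγ1 : γ ≤ (min (hF ▸ 𝔠).gamma0 1) ^ 2) (K : ℕ),
                AlphaInputsT3AC.SmallFactor71OfRecT3 F (hF ▸ 𝔠) γ hγ hγ1 K) ∧
              ∀ (γ : ℝ) (hγ : 0 < γ) (hγ1 : γ ≤ (min (hF ▸ 𝔠).gamma0 1) ^ 2) (K : ℕ),
                (∃ Ut : (k : ℕ) → GaugeField (F.P K) k (Matrix.specialUnitaryGroup (Fin 2) ℂ) →
                    GaugeField (F.P K) 0 (Matrix.specialUnitaryGroup (Fin 2) ℂ),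
                  AlphaInputsT3AC.TrivMinimiserRowsT3 F (hF ▸ 𝔠) γ hγ hγ1 a₀ a₁ K Ut) →
                ∃ Ut : (k : ℕ) → GaugeField (F.P K) k (Matrix.specialUnitaryGroup (Fin 2) ℂ) →
                    GaugeField (F.P K) 0 (Matrix.specialUnitaryGroup (Fin 2) ℂ),
                  AlphaInputsT3AC.TrivMinimiserRowsT3 F (hF ▸ 𝔠) γ hγ hγ1 a₀ a₁ K Ut ∧
                    AlphaInputsT3AC.DataRowsT3XsChiSel F (hF ▸ 𝔠) γ hγ hγ1 K Ut) :
    ∀ (b₁ p₁ : ℝ), ∃ (b₀ p₀ : ℝ), b₁ ≤ b₀ ∧ p₁ ≤ p₀ ∧ 0 < b₀ ∧ 2 < p₀ ∧ ∀ (m : ℕ), 0 < m → ∃ γ₁ : ℝ, 0 < γ₁ ∧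
      ∀ (F : T3Family) (γ : ℝ), F.L = L → 0 < γ → γ ≤ γ₁ → T3UnitScaleTilt.HistoryTailAt F γ b₀ p₀ m := by
  obtain ⟨a₀, a₁, B₃, ha₀, ha₁, hB₃, hT, -⟩ := hT8_L
  obtain ⟨B₀, A₀, A₁, hA₀, hA₁, h⟩ := hrows_L
  exact historyTailBody_of_intCoreRecRows_L hLo hL
    (intCoreRecRows_of_laneRecordsV4Chi L
      (alphaInputsT3ACv4RecChi_of_pinnedPartsRecSelXsV4Chi
        (pinnedPartsT3ACRecSelXsV4Chi_of_thm1_rows hL ⟨a₀, a₁, B₃, ha₀, ha₁, hB₃, hT⟩ hA₀ hA₁ h)))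

/-! ## §3 … from the row EX at `L` and the row (O‴χₛ) at `L` (T8 at `L` by ✓`thm1In8GlobalMinAt_of_halving_exist_L`, H = ✓`stub_halvingStep L hL`) -/

/-- **`⟨HistoryTailL's body at L⟩ ⟸ ⟨EX at L⟩ ∧ ⟨(O‴χₛ) at L⟩`** (odd `L > 1`) — the per-block-size edition of ✓`historyTailL_of_existenceMinimalOrbit_selXsV4DataRows_allL`:
T8 at `L` from the halving at `L` (✓`stub_halvingStep L hL`) and EX at `L` (✓`IntLT8OfHalvingExist.thm1In8GlobalMinAt_of_halving_exist_L`), then §2.  `hEX_L` = the registry row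
`stub_existenceMinimalOrbit` read at `L`, VERBATIM. [cite: Balaban1985Variational, Thm 1 (8) p.279, Prop. 7 p.299, Prop. 8 p.304; Balaban1985UV3, (47) p.267 and (67)–(71) p.273] -/
theorem historyTailBody_of_existence_selXsV4DataRows_L {L : ℕ} (hLo : Odd L) (hL : 1 < L)
    (hEX_L : ∀ (B₃ : ℝ), 4 < B₃ → ∃ a₁' O₁ : ℝ, 0 < a₁' ∧ 1 ≤ O₁ ∧
      ∀ (F : T3Family), F.L = L → ∀ (n K : ℕ) (hnK : n < K) (ε₁ : ℝ), 0 < ε₁ →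
        ∀ V : GaugeField (F.P n) 0 (Matrix.specialUnitaryGroup (Fin 2) ℂ), PlaqSmall ε₁ V →
          ∀ U₀ : GaugeField (F.P K) 0 (Matrix.specialUnitaryGroup (Fin 2) ℂ), RegPr F n K ((L : ℝ) ^ 3 * B₃ * ε₁) U₀ → U₀ ∈ fibre F ℰp n K hnK.le V →
            ε₁ ≤ a₁' → ∃ U ∈ regFibrePr F n K hnK.le (O₁ * (L : ℝ) ^ 3 * B₃ * ε₁) V,
              IsMinOn (fun W : GaugeField (F.P K) 0 (Matrix.specialUnitaryGroup (Fin 2) ℂ) => wilsonAction4 W)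
                (regFibrePr F n K hnK.le (O₁ * (L : ℝ) ^ 3 * B₃ * ε₁) V) U)
    (hrows_L : ∃ (B₀ A₀ A₁ : ℝ), 0 < A₀ ∧ 0 < A₁ ∧
      ∀ (B a₀ a₁ : ℝ), B₀ ≤ B → 1 ≤ 2 * B → 0 < a₀ → a₀ ≤ A₀ → 0 < a₁ → a₁ ≤ A₁ → B * a₁ ≤ a₀ →
        (143 * ((((3 + 4 : ℕ) : ℝ)) ^ 2 / 4) ^ 2) * (2 * (B * a₁)) ≤ 1 / 3 →
        2 * (2 * (B * a₁)) ≤ 2 * deltaSU (Fin 2) / (((3 + 4) * L : ℕ) : ℝ) ^ 2 →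
        Thm1GlobalMinAt L a₀ a₁ B →
        ∃ (b₁ p₁ : ℝ), ∀ (b₀ p₀ : ℝ), b₁ ≤ b₀ → p₁ ≤ p₀ →
          ∃ 𝔠 : AlphaConsts L (suGroupModel 2).N, 𝔠.b₀ = b₀ ∧ 𝔠.p₀ = p₀ ∧ 𝔠.B₃ = B ∧
            4 * 𝔠.B₃ * (L : ℝ) ^ 2 * avgWindowFactor L ≤ 𝔠.C68 ∧
            Real.exp (𝔠.p₀ - 1) ≤ 3 * C0 3 * 𝔠.C68 * (𝔠.b₀ * Q0 𝔠.p₀) ∧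
            (𝔠.b₀ * Q0 𝔠.p₀) * (2 * (L : ℝ) ^ 2 * avgWindowFactor L) ^ 2 ≤ 3 * C0 3 * 𝔠.C68 * a₁ ^ 2 ∧
            ∀ (F : T3Family) (hF : F.L = L),
              (∀ (γ : ℝ) (hγ : 0 < γ) (hγ1 : γ ≤ (min (hF ▸ 𝔠).gamma0 1) ^ 2) (K : ℕ),
                AlphaInputsT3AC.SmallFactor71OfRecT3 F (hF ▸ 𝔠) γ hγ hγ1 K) ∧
              ∀ (γ : ℝ) (hγ : 0 < γ) (hγ1 : γ ≤ (min (hF ▸ 𝔠).gamma0 1) ^ 2) (K : ℕ),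
                (∃ Ut : (k : ℕ) → GaugeField (F.P K) k (Matrix.specialUnitaryGroup (Fin 2) ℂ) →
                    GaugeField (F.P K) 0 (Matrix.specialUnitaryGroup (Fin 2) ℂ),
                  AlphaInputsT3AC.TrivMinimiserRowsT3 F (hF ▸ 𝔠) γ hγ hγ1 a₀ a₁ K Ut) →
                ∃ Ut : (k : ℕ) → GaugeField (F.P K) k (Matrix.specialUnitaryGroup (Fin 2) ℂ) →
                    GaugeField (F.P K) 0 (Matrix.specialUnitaryGroup (Fin 2) ℂ),
                  AlphaInputsT3AC.TrivMinimiserRowsT3 F (hF ▸ 𝔠) γ hγ hγ1 a₀ a₁ K Ut ∧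
                    AlphaInputsT3AC.DataRowsT3XsChiSel F (hF ▸ 𝔠) γ hγ hγ1 K Ut) :
    ∀ (b₁ p₁ : ℝ), ∃ (b₀ p₀ : ℝ), b₁ ≤ b₀ ∧ p₁ ≤ p₀ ∧ 0 < b₀ ∧ 2 < p₀ ∧ ∀ (m : ℕ), 0 < m → ∃ γ₁ : ℝ, 0 < γ₁ ∧
      ∀ (F : T3Family) (γ : ℝ), F.L = L → 0 < γ → γ ≤ γ₁ → T3UnitScaleTilt.HistoryTailAt F γ b₀ p₀ m :=
  historyTailBody_of_thm1In8_selXsV4DataRows_L hLo hL (thm1In8GlobalMinAt_of_halving_exist_L hL (stub_halvingStep L hL) hEX_L) hrows_L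

/-! ## §4 ★★★ AT EVERY ODD `L ≥ 5`: `HistoryTailL`'s body ⟸ the one NODE-O row (O‴χₛ) at `L` — EX discharged by ✓`exBody_guarded_five` -/

/-- ★★★ **AT EVERY ODD BLOCK SIZE `L ≥ 5` THE CRUX `HistoryTailL` (stmt-QuantumFields-19936) READS ITS ONE NODE-O ROW AT `L` AND NOTHING ELSE**:
`⟨HistoryTailL's body at L⟩ ⟸ ⟨(O‴χₛ) Sel∕Xs v4 supplier rows at L⟩`, the shared registry row EX being the OUTRIGHT theorem ✓`EXGuardedFiveOutright.exBody_guarded_five` there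
(px16 g16, over the guarded edition chain S01ᵍ–S55ᵍ).  `L = 3` is NOT covered (EX at `L = 3` ⟸ `hThm2S3`). [cite: Balaban1985Variational, Thm 1 (8) p.279, Prop. 7 p.299, Prop. 8 p.304; Balaban1985UV3, (5) p.256, (47) p.267, (67)–(71) p.273 and Thm 2 p.272] -/
theorem historyTailBody_five_of_selXsV4DataRows {L : ℕ} (hLo : Odd L) (h5 : 5 ≤ L)
    (hrows_L : ∃ (B₀ A₀ A₁ : ℝ), 0 < A₀ ∧ 0 < A₁ ∧
      ∀ (B a₀ a₁ : ℝ), B₀ ≤ B → 1 ≤ 2 * B → 0 < a₀ → a₀ ≤ A₀ → 0 < a₁ → a₁ ≤ A₁ → B * a₁ ≤ a₀ →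
        (143 * ((((3 + 4 : ℕ) : ℝ)) ^ 2 / 4) ^ 2) * (2 * (B * a₁)) ≤ 1 / 3 →
        2 * (2 * (B * a₁)) ≤ 2 * deltaSU (Fin 2) / (((3 + 4) * L : ℕ) : ℝ) ^ 2 →
        Thm1GlobalMinAt L a₀ a₁ B →
        ∃ (b₁ p₁ : ℝ), ∀ (b₀ p₀ : ℝ), b₁ ≤ b₀ → p₁ ≤ p₀ →
          ∃ 𝔠 : AlphaConsts L (suGroupModel 2).N, 𝔠.b₀ = b₀ ∧ 𝔠.p₀ = p₀ ∧ 𝔠.B₃ = B ∧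
            4 * 𝔠.B₃ * (L : ℝ) ^ 2 * avgWindowFactor L ≤ 𝔠.C68 ∧
            Real.exp (𝔠.p₀ - 1) ≤ 3 * C0 3 * 𝔠.C68 * (𝔠.b₀ * Q0 𝔠.p₀) ∧
            (𝔠.b₀ * Q0 𝔠.p₀) * (2 * (L : ℝ) ^ 2 * avgWindowFactor L) ^ 2 ≤ 3 * C0 3 * 𝔠.C68 * a₁ ^ 2 ∧
            ∀ (F : T3Family) (hF : F.L = L),
              (∀ (γ : ℝ) (hγ : 0 < γ) (hγ1 : γ ≤ (min (hF ▸ 𝔠).gamma0 1) ^ 2) (K : ℕ),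
                AlphaInputsT3AC.SmallFactor71OfRecT3 F (hF ▸ 𝔠) γ hγ hγ1 K) ∧
              ∀ (γ : ℝ) (hγ : 0 < γ) (hγ1 : γ ≤ (min (hF ▸ 𝔠).gamma0 1) ^ 2) (K : ℕ),
                (∃ Ut : (k : ℕ) → GaugeField (F.P K) k (Matrix.specialUnitaryGroup (Fin 2) ℂ) →
                    GaugeField (F.P K) 0 (Matrix.specialUnitaryGroup (Fin 2) ℂ),
                  AlphaInputsT3AC.TrivMinimiserRowsT3 F (hF ▸ 𝔠) γ hγ hγ1 a₀ a₁ K Ut) →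
                ∃ Ut : (k : ℕ) → GaugeField (F.P K) k (Matrix.specialUnitaryGroup (Fin 2) ℂ) →
                    GaugeField (F.P K) 0 (Matrix.specialUnitaryGroup (Fin 2) ℂ),
                  AlphaInputsT3AC.TrivMinimiserRowsT3 F (hF ▸ 𝔠) γ hγ hγ1 a₀ a₁ K Ut ∧
                    AlphaInputsT3AC.DataRowsT3XsChiSel F (hF ▸ 𝔠) γ hγ hγ1 K Ut) :
    ∀ (b₁ p₁ : ℝ), ∃ (b₀ p₀ : ℝ), b₁ ≤ b₀ ∧ p₁ ≤ p₀ ∧ 0 < b₀ ∧ 2 < p₀ ∧ ∀ (m : ℕ), 0 < m → ∃ γ₁ : ℝ, 0 < γ₁ ∧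
      ∀ (F : T3Family) (γ : ℝ), F.L = L → 0 < γ → γ ≤ γ₁ → T3UnitScaleTilt.HistoryTailAt F γ b₀ p₀ m :=
  historyTailBody_of_existence_selXsV4DataRows_L hLo (by omega) (exBody_guarded_five L (by omega) h5) hrows_L

/-! ## §5 The fixed-block leaf `YM3TorusSU2At L₀` at every `L₀ ≥ 5` from the per-`L₀` bodies of the two sibling cruxes — and from {20520, (O‴χₛ) at `L₀`} -/

/-- **`YM3TorusSU2At L₀ ⟸ ⟨MinimiserStabilityRegPr guarded at L ≥ 5⟩ ∧ ⟨FluctuationComparisonRegPrIntL's body at L₀⟩ ∧ ⟨HistoryTailL's body at L₀⟩`, every `L₀ ≥ 5`** —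
✓p785993 §4 `MinimiserStabilityRegPrGuarded.ym3TorusSU2At_of_guardedCrux` with its two sibling hypotheses re-keyed to their bodies AT `L₀` (that proof reads `h201 F.L` and
`hK2 F.L b₁ p₁` only): E-INT glue `(c, b₁, p₁)` from the interior comparison at `L₀`, the profile from the tail at `L₀`, the stability crux at the dilated profile, `ε₀ := min`,
`m := max (max m₁ m₂) 1`, refinement `γL^{-n} ↓ 0`, ✓`T3InteriorExcision.unitTiltTail_of_interior`, ✓`continuumYM3Torus_of_refine_unitTiltTail`; `γ₁ := 1`.  CONDITIONAL on the
three hypotheses. [cite: Balaban1985UV3, (1)-(3) p.256; Balaban1987RG1, §0 p.251; Balaban1985Variational, Thm 1 p.279] -/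
theorem ym3TorusSU2At_of_guardedCrux_bodies (L₀ : ℕ) (h5 : 5 ≤ L₀)
    (h200g : ∀ (L : ℕ), 5 ≤ L → ∃ ε₁ : ℝ, 0 < ε₁ ∧ ∀ (ε₀ : ℝ), 0 < ε₀ → ε₀ ≤ ε₁ → ∃ m₀ : ℕ, ∀ (m : ℕ), m₀ ≤ m →
      ∀ (b₀ p₀ : ℝ), 0 < b₀ → 2 < p₀ → ∃ γ₁ : ℝ, 0 < γ₁ ∧ ∀ (F : T3Family) (γ : ℝ), F.L = L → 0 < γ → γ ≤ γ₁ →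
        MinimiserStabilityRegPrAt F γ b₀ p₀ m ε₀)
    (h201_L₀ : ∃ (c b₁ p₁ : ℝ), 0 < c ∧ c ≤ 1 ∧ ∀ (b₀ p₀ : ℝ), b₁ ≤ b₀ → p₁ ≤ p₀ → 0 < b₀ → 2 < p₀ → ∃ ε₁ : ℝ, 0 < ε₁ ∧
      ∀ (ε₀ : ℝ), 0 < ε₀ → ε₀ ≤ ε₁ → ∃ m₀ : ℕ, ∀ (m : ℕ), m₀ ≤ m → ∃ γ₁ : ℝ, 0 < γ₁ ∧
        ∀ (F : T3Family) (γ : ℝ), F.L = L₀ → 0 < γ → γ ≤ γ₁ → FluctuationComparisonRegPrIntAt F γ b₀ p₀ m c ε₀)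
    (hK2_L₀ : ∀ (b₁ p₁ : ℝ), ∃ (b₀ p₀ : ℝ), b₁ ≤ b₀ ∧ p₁ ≤ p₀ ∧ 0 < b₀ ∧ 2 < p₀ ∧ ∀ (m : ℕ), 0 < m → ∃ γ₁ : ℝ, 0 < γ₁ ∧
      ∀ (F : T3Family) (γ : ℝ), F.L = L₀ → 0 < γ → γ ≤ γ₁ → T3UnitScaleTilt.HistoryTailAt F γ b₀ p₀ m) :
    YM3TorusSU2At L₀ := by
  -- adapted from ✓p785993 §4 `ym3TorusSU2At_of_guardedCrux` (`h201 F.L` ↦ `h201_L₀`, `hK2 F.L b₁ p₁` ↦ `hK2_L₀ b₁ p₁` after `subst`)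
  refine ⟨1, one_pos, fun F γ hFL hγ _ => ?_⟩
  subst hFL
  obtain ⟨c, b₁, p₁, hc0, hc1, hB⟩ := h201_L₀
  obtain ⟨b₀', p₀, hb₁, hp₁, hb₀', hp₀, hT⟩ := hK2_L₀ b₁ p₁
  have hb₀ : 0 < b₀' / c := div_pos hb₀' hc0
  have hb₁' : b₁ ≤ b₀' / c := by
    refine hb₁.trans ?_
    rw [le_div_iff₀ hc0]
    exact mul_le_of_le_one_right hb₀'.le hc1
  have hcb : c * (b₀' / c) = b₀' := by field_simp
  obtain ⟨ε₁, hε₁, hA⟩ := h200g F.L h5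
  obtain ⟨ε₁', hε₁', hB'⟩ := hB (b₀' / c) p₀ hb₁' hp₁ hb₀ hp₀
  obtain ⟨m₁, hm₁⟩ := hA (min ε₁ ε₁') (lt_min hε₁ hε₁') (min_le_left _ _)
  obtain ⟨m₂, hm₂⟩ := hB' (min ε₁ ε₁') (lt_min hε₁ hε₁') (min_le_right _ _)
  obtain ⟨γ₂, hγ₂, hT'⟩ := hT (max (max m₁ m₂) 1) (lt_of_lt_of_le Nat.one_pos (le_max_right _ _))
  obtain ⟨γ₃, hγ₃, hA'⟩ := hm₁ (max (max m₁ m₂) 1) ((le_max_left _ _).trans (le_max_left _ _)) (b₀' / c) p₀ hb₀ hp₀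
  obtain ⟨γ₄, hγ₄, hB''⟩ := hm₂ (max (max m₁ m₂) 1) ((le_max_right _ _).trans (le_max_left _ _))
  have hL : (1 : ℝ) < F.L := by exact_mod_cast F.hL.2
  have hL0 : (0 : ℝ) < F.L := zero_lt_one.trans hL
  have hγs : 0 < min (min γ₂ (min γ₃ γ₄)) 1 := lt_min (lt_min hγ₂ (lt_min hγ₃ hγ₄)) one_pos
  obtain ⟨n, hn⟩ := ((tendsto_pow_atTop_nhds_zero_of_lt_one (inv_nonneg.mpr hL0.le)
    (inv_lt_one_of_one_lt₀ hL)).eventually (ge_mem_nhds (div_pos hγs hγ))).exists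
  have hpos : 0 < γ * ((F.L : ℝ)⁻¹) ^ n := mul_pos hγ (pow_pos (inv_pos.mpr hL0) n)
  have hle : γ * ((F.L : ℝ)⁻¹) ^ n ≤ min (min γ₂ (min γ₃ γ₄)) 1 := by
    have e := mul_le_mul_of_nonneg_left hn hγ.le
    rwa [mul_div_cancel₀ _ hγ.ne'] at e
  have hle₂ : γ * ((F.L : ℝ)⁻¹) ^ n ≤ γ₂ := hle.trans ((min_le_left _ _).trans (min_le_left _ _))
  have hle₃ : γ * ((F.L : ℝ)⁻¹) ^ n ≤ γ₃ :=
    hle.trans ((min_le_left _ _).trans ((min_le_right _ _).trans (min_le_left _ _)))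
  have hle₄ : γ * ((F.L : ℝ)⁻¹) ^ n ≤ γ₄ :=
    hle.trans ((min_le_left _ _).trans ((min_le_right _ _).trans (min_le_right _ _)))
  have hle1 : γ * ((F.L : ℝ)⁻¹) ^ n ≤ 1 := hle.trans (min_le_right _ _)
  have hTn : HistoryTailAt (F.refine n) (γ * ((F.L : ℝ)⁻¹) ^ n) (c * (b₀' / c)) p₀ (max (max m₁ m₂) 1) := by
    rw [hcb]
    exact hT' (F.refine n) _ rfl hpos hle₂
  obtain ⟨r, w, w', hr, hw, hw', h⟩ :=
    T3InteriorExcision.unitTiltTail_of_interior hpos hle1 hb₀ hc1 (hA' (F.refine n) _ rfl hpos hle₃) (hB'' (F.refine n) _ rfl hpos hle₄) hTn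
  exact continuumYM3Torus_of_refine_unitTiltTail F ℰp measurableE_ℰp n hγ.le hr hw hw' h

/-- ★★★ **THE FIXED-BLOCK LEAF AT EVERY `L₀ ≥ 5` FROM 20520's BODY AT `L₀` AND THE ONE NODE-O ROW (O‴χₛ) AT `L₀`**:
`YM3TorusSU2At L₀ ⟸ ⟨FluctuationComparisonRegPrIntL's body at L₀⟩ ∧ ⟨(O‴χₛ) Sel∕Xs v4 supplier rows at L₀⟩` — `h200g` := ✓`minimiserStabilityRegPr_guarded_five` (EX and the whole
crux 19200 OUTRIGHT at `L ≥ 5`), `hK2_L₀` := §4 (`Odd L₀` from the family's `F.hL`; even `L₀` carry no family).  CONDITIONAL on the two displayed inputs; `γ₁ := 1`.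
[cite: Balaban1985UV3, (1)-(3) p.256, (47) p.267 and (67)–(71) p.273; Balaban1985Variational, Thm 1 (8) p.279, Prop. 7 p.299, Prop. 8 p.304; Balaban1987RG1, §0 p.251] -/
theorem ym3TorusSU2At_five_of_intLBody_selXsV4DataRows (L₀ : ℕ) (h5 : 5 ≤ L₀)
    (h201_L₀ : ∃ (c b₁ p₁ : ℝ), 0 < c ∧ c ≤ 1 ∧ ∀ (b₀ p₀ : ℝ), b₁ ≤ b₀ → p₁ ≤ p₀ → 0 < b₀ → 2 < p₀ → ∃ ε₁ : ℝ, 0 < ε₁ ∧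
      ∀ (ε₀ : ℝ), 0 < ε₀ → ε₀ ≤ ε₁ → ∃ m₀ : ℕ, ∀ (m : ℕ), m₀ ≤ m → ∃ γ₁ : ℝ, 0 < γ₁ ∧
        ∀ (F : T3Family) (γ : ℝ), F.L = L₀ → 0 < γ → γ ≤ γ₁ → FluctuationComparisonRegPrIntAt F γ b₀ p₀ m c ε₀)
    (hrows_L₀ : ∃ (B₀ A₀ A₁ : ℝ), 0 < A₀ ∧ 0 < A₁ ∧
      ∀ (B a₀ a₁ : ℝ), B₀ ≤ B → 1 ≤ 2 * B → 0 < a₀ → a₀ ≤ A₀ → 0 < a₁ → a₁ ≤ A₁ → B * a₁ ≤ a₀ →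
        (143 * ((((3 + 4 : ℕ) : ℝ)) ^ 2 / 4) ^ 2) * (2 * (B * a₁)) ≤ 1 / 3 →
        2 * (2 * (B * a₁)) ≤ 2 * deltaSU (Fin 2) / (((3 + 4) * L₀ : ℕ) : ℝ) ^ 2 →
        Thm1GlobalMinAt L₀ a₀ a₁ B →
        ∃ (b₁ p₁ : ℝ), ∀ (b₀ p₀ : ℝ), b₁ ≤ b₀ → p₁ ≤ p₀ →
          ∃ 𝔠 : AlphaConsts L₀ (suGroupModel 2).N, 𝔠.b₀ = b₀ ∧ 𝔠.p₀ = p₀ ∧ 𝔠.B₃ = B ∧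
            4 * 𝔠.B₃ * (L₀ : ℝ) ^ 2 * avgWindowFactor L₀ ≤ 𝔠.C68 ∧
            Real.exp (𝔠.p₀ - 1) ≤ 3 * C0 3 * 𝔠.C68 * (𝔠.b₀ * Q0 𝔠.p₀) ∧
            (𝔠.b₀ * Q0 𝔠.p₀) * (2 * (L₀ : ℝ) ^ 2 * avgWindowFactor L₀) ^ 2 ≤ 3 * C0 3 * 𝔠.C68 * a₁ ^ 2 ∧
            ∀ (F : T3Family) (hF : F.L = L₀),
              (∀ (γ : ℝ) (hγ : 0 < γ) (hγ1 : γ ≤ (min (hF ▸ 𝔠).gamma0 1) ^ 2) (K : ℕ),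
                AlphaInputsT3AC.SmallFactor71OfRecT3 F (hF ▸ 𝔠) γ hγ hγ1 K) ∧
              ∀ (γ : ℝ) (hγ : 0 < γ) (hγ1 : γ ≤ (min (hF ▸ 𝔠).gamma0 1) ^ 2) (K : ℕ),
                (∃ Ut : (k : ℕ) → GaugeField (F.P K) k (Matrix.specialUnitaryGroup (Fin 2) ℂ) →
                    GaugeField (F.P K) 0 (Matrix.specialUnitaryGroup (Fin 2) ℂ),
                  AlphaInputsT3AC.TrivMinimiserRowsT3 F (hF ▸ 𝔠) γ hγ hγ1 a₀ a₁ K Ut) →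
                ∃ Ut : (k : ℕ) → GaugeField (F.P K) k (Matrix.specialUnitaryGroup (Fin 2) ℂ) →
                    GaugeField (F.P K) 0 (Matrix.specialUnitaryGroup (Fin 2) ℂ),
                  AlphaInputsT3AC.TrivMinimiserRowsT3 F (hF ▸ 𝔠) γ hγ hγ1 a₀ a₁ K Ut ∧
                    AlphaInputsT3AC.DataRowsT3XsChiSel F (hF ▸ 𝔠) γ hγ hγ1 K Ut) :
    YM3TorusSU2At L₀ := by
  by_cases hLo : Odd L₀
  · exact ym3TorusSU2At_of_guardedCrux_bodies L₀ h5 minimiserStabilityRegPr_guarded_five h201_L₀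
      (historyTailBody_five_of_selXsV4DataRows hLo h5 hrows_L₀)
  · exact T3YM3TorusStatement.yM3TorusSU2At_of_not_admissible fun h => hLo h.1

/-- ★★★ **THE FIXED-BLOCK LEAF AT EVERY `L₀ ≥ 5` ⟸ `FluctuationComparisonRegPrIntL` ∧ ⟨(O‴χₛ) at L₀⟩** — the sibling crux stmt-QuantumFields-20520 BY NAME (read at `L₀`),
19936 replaced by its one NODE-O row at `L₀`, 19200 ∕ EX gone.  CONDITIONAL on the two inputs. [cite: Balaban1985UV3, (1)-(3) p.256 and (67)–(71) p.273; Balaban1987RG1, §0 p.251] -/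
theorem ym3TorusSU2At_five_of_intL_selXsV4DataRows (L₀ : ℕ) (h5 : 5 ≤ L₀) (h201 : FluctuationComparisonRegPrIntL)
    (hrows_L₀ : ∃ (B₀ A₀ A₁ : ℝ), 0 < A₀ ∧ 0 < A₁ ∧
      ∀ (B a₀ a₁ : ℝ), B₀ ≤ B → 1 ≤ 2 * B → 0 < a₀ → a₀ ≤ A₀ → 0 < a₁ → a₁ ≤ A₁ → B * a₁ ≤ a₀ →
        (143 * ((((3 + 4 : ℕ) : ℝ)) ^ 2 / 4) ^ 2) * (2 * (B * a₁)) ≤ 1 / 3 →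
        2 * (2 * (B * a₁)) ≤ 2 * deltaSU (Fin 2) / (((3 + 4) * L₀ : ℕ) : ℝ) ^ 2 →
        Thm1GlobalMinAt L₀ a₀ a₁ B →
        ∃ (b₁ p₁ : ℝ), ∀ (b₀ p₀ : ℝ), b₁ ≤ b₀ → p₁ ≤ p₀ →
          ∃ 𝔠 : AlphaConsts L₀ (suGroupModel 2).N, 𝔠.b₀ = b₀ ∧ 𝔠.p₀ = p₀ ∧ 𝔠.B₃ = B ∧
            4 * 𝔠.B₃ * (L₀ : ℝ) ^ 2 * avgWindowFactor L₀ ≤ 𝔠.C68 ∧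
            Real.exp (𝔠.p₀ - 1) ≤ 3 * C0 3 * 𝔠.C68 * (𝔠.b₀ * Q0 𝔠.p₀) ∧
            (𝔠.b₀ * Q0 𝔠.p₀) * (2 * (L₀ : ℝ) ^ 2 * avgWindowFactor L₀) ^ 2 ≤ 3 * C0 3 * 𝔠.C68 * a₁ ^ 2 ∧
            ∀ (F : T3Family) (hF : F.L = L₀),
              (∀ (γ : ℝ) (hγ : 0 < γ) (hγ1 : γ ≤ (min (hF ▸ 𝔠).gamma0 1) ^ 2) (K : ℕ),
                AlphaInputsT3AC.SmallFactor71OfRecT3 F (hF ▸ 𝔠) γ hγ hγ1 K) ∧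
              ∀ (γ : ℝ) (hγ : 0 < γ) (hγ1 : γ ≤ (min (hF ▸ 𝔠).gamma0 1) ^ 2) (K : ℕ),
                (∃ Ut : (k : ℕ) → GaugeField (F.P K) k (Matrix.specialUnitaryGroup (Fin 2) ℂ) →
                    GaugeField (F.P K) 0 (Matrix.specialUnitaryGroup (Fin 2) ℂ),
                  AlphaInputsT3AC.TrivMinimiserRowsT3 F (hF ▸ 𝔠) γ hγ hγ1 a₀ a₁ K Ut) →
                ∃ Ut : (k : ℕ) → GaugeField (F.P K) k (Matrix.specialUnitaryGroup (Fin 2) ℂ) →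
                    GaugeField (F.P K) 0 (Matrix.specialUnitaryGroup (Fin 2) ℂ),
                  AlphaInputsT3AC.TrivMinimiserRowsT3 F (hF ▸ 𝔠) γ hγ hγ1 a₀ a₁ K Ut ∧
                    AlphaInputsT3AC.DataRowsT3XsChiSel F (hF ▸ 𝔠) γ hγ hγ1 K Ut) :
    YM3TorusSU2At L₀ :=
  ym3TorusSU2At_five_of_intLBody_selXsV4DataRows L₀ h5 (h201 L₀) hrows_L₀

/-- **PRINT's ADMISSIBLE-BLOCK LEAF `YM3TorusSU2Adm` (odd `L₀ > 11`) ⟸ `FluctuationComparisonRegPrIntL` ∧ ⟨19936's registered row (O‴χₛ), VERBATIM (every odd `L > 1`)⟩** —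
the sharpening of ✓`ym3TorusSU2Adm_of_siblings` in which `HistoryTailL` is replaced by its one NODE-O row (`11 < L₀ ⇒ 5 ≤ L₀`).  CONDITIONAL on the two inputs.
[cite: Balaban1987RG1, §0 p.251; Balaban1985UV3, (1)-(3) p.256 and (67)–(71) p.273] -/
theorem ym3TorusSU2Adm_of_intL_selXsV4DataRows (h201 : FluctuationComparisonRegPrIntL)
    (hrows : ∀ L : ℕ, Odd L → 1 < L → ∃ (B₀ A₀ A₁ : ℝ), 0 < A₀ ∧ 0 < A₁ ∧
      ∀ (B a₀ a₁ : ℝ), B₀ ≤ B → 1 ≤ 2 * B → 0 < a₀ → a₀ ≤ A₀ → 0 < a₁ → a₁ ≤ A₁ → B * a₁ ≤ a₀ →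
        (143 * ((((3 + 4 : ℕ) : ℝ)) ^ 2 / 4) ^ 2) * (2 * (B * a₁)) ≤ 1 / 3 →
        2 * (2 * (B * a₁)) ≤ 2 * deltaSU (Fin 2) / (((3 + 4) * L : ℕ) : ℝ) ^ 2 →
        Thm1GlobalMinAt L a₀ a₁ B →
        ∃ (b₁ p₁ : ℝ), ∀ (b₀ p₀ : ℝ), b₁ ≤ b₀ → p₁ ≤ p₀ →
          ∃ 𝔠 : AlphaConsts L (suGroupModel 2).N, 𝔠.b₀ = b₀ ∧ 𝔠.p₀ = p₀ ∧ 𝔠.B₃ = B ∧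
            4 * 𝔠.B₃ * (L : ℝ) ^ 2 * avgWindowFactor L ≤ 𝔠.C68 ∧
            Real.exp (𝔠.p₀ - 1) ≤ 3 * C0 3 * 𝔠.C68 * (𝔠.b₀ * Q0 𝔠.p₀) ∧
            (𝔠.b₀ * Q0 𝔠.p₀) * (2 * (L : ℝ) ^ 2 * avgWindowFactor L) ^ 2 ≤ 3 * C0 3 * 𝔠.C68 * a₁ ^ 2 ∧
            ∀ (F : T3Family) (hF : F.L = L),
              (∀ (γ : ℝ) (hγ : 0 < γ) (hγ1 : γ ≤ (min (hF ▸ 𝔠).gamma0 1) ^ 2) (K : ℕ),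
                AlphaInputsT3AC.SmallFactor71OfRecT3 F (hF ▸ 𝔠) γ hγ hγ1 K) ∧
              ∀ (γ : ℝ) (hγ : 0 < γ) (hγ1 : γ ≤ (min (hF ▸ 𝔠).gamma0 1) ^ 2) (K : ℕ),
                (∃ Ut : (k : ℕ) → GaugeField (F.P K) k (Matrix.specialUnitaryGroup (Fin 2) ℂ) →
                    GaugeField (F.P K) 0 (Matrix.specialUnitaryGroup (Fin 2) ℂ),
                  AlphaInputsT3AC.TrivMinimiserRowsT3 F (hF ▸ 𝔠) γ hγ hγ1 a₀ a₁ K Ut) →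
                ∃ Ut : (k : ℕ) → GaugeField (F.P K) k (Matrix.specialUnitaryGroup (Fin 2) ℂ) →
                    GaugeField (F.P K) 0 (Matrix.specialUnitaryGroup (Fin 2) ℂ),
                  AlphaInputsT3AC.TrivMinimiserRowsT3 F (hF ▸ 𝔠) γ hγ hγ1 a₀ a₁ K Ut ∧
                    AlphaInputsT3AC.DataRowsT3XsChiSel F (hF ▸ 𝔠) γ hγ hγ1 K Ut) :
    YM3TorusSU2Adm :=
  fun L₀ hodd h11 => ym3TorusSU2At_of_guardedCrux_bodies L₀ (by omega) minimiserStabilityRegPr_guarded_five (h201 L₀)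
    (historyTailBody_five_of_selXsV4DataRows hodd (by omega) (hrows L₀ hodd (by omega)))

end Summit.QuantumFields.YangMills.Theorems.HistoryTailGuardedFive

end
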